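import Summits.BirchSwinnertonDyer.BirchSwinnertonDyer.Theorems.ByReductionTypeAtTwoRankOneAtTwoOneDoorLawBottomDefs
import Summits.BirchSwinnertonDyer.Rank1Residual.F1Sign2.KummerEntanglementAtTwo
import Literature.NumberTheory.EllipticCurves.ArchimedeanLocalConditionTorsion
import Literature.NumberTheory.EllipticCurves.HeegnerPointsKolyvaginPairing
import HarnessLib

/-!
# Cell `bsd-f1-sign2`, ES-19: THE REAL SIGNATURE OF THE ČEBOTAREV BLIND SPOT AT `2` (-es g10, MEMO-es §19; CANDIDATES rows ES-19a′/a/b/c/u)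

TYPER FILING (cell `bsd-f1-sign2`, seat `-ty` g10; -es g10 filing ask D-es-52 «port `data-es/g10/Sketch19.lean` fc997b5f67915794 VERBATIM as
`F1Sign2/RealSignatureAtTwo.lean` after REF1 (D-es-53); `@[conjecture]` on ES-19u only; no new R18 decls asked»; farm rc 0; BC7 Probe19 4/4
CLEAN b0d1986d982b9559): the sketch body VERBATIM — same namespace `…Rank1Residual.F1Sign2.RealSignatureAtTwo`, same imports (one-door
bottom defs `…Theorems.ByReductionTypeAtTwoRankOneAtTwoOneDoorLawBottomDefs` for `DoorIndexLawUpperCAtTwo` and its carriers;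
`F1Sign2.KummerEntanglementAtTwo`; `Literature.…ArchimedeanLocalConditionTorsion` for `two_nsmul_mem_localRestrictionKer_infinitePlace`;
`Literature.…HeegnerPointsKolyvaginPairing`).  Decls: ES-19b `InflationLineAtTwoPow` (support, theorem-grade), ES-19a′
`RealSignatureOfBlindSpotAtTwo` (LEAD, theorem-grade candidate), ES-19a `SelmerRestrictionInjectivePosDiscAtTwo` (RIS⁺) + PROVED glue
`selmerRestrictionInjectivePosDisc_of_realSignature`, `selmer_eq_zero_of_dies`; ES-19c kernel lemma `mem_selmerLocalKer_infinitePlace_of_eq_two_nsmul`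
(PROVED, from the tree); ES-19u `DoorIndexLawUpperCAtTwoMinimalPos` (payoff, CONJECTURE: `@[conjecture]`, typer edit) + PROVED glue
`doorIndexLawUpperCAtTwoMinimalPos_of_upperC` (U ⟹ its `Δ > 0` minimal-door rung) and the import-free reading `minimalPos_conclusion_iff`.
Typer edits = this header, the one attribute, the REF1, REF2 sentences, and the sketch's `set_option linter.dupNamespace false` dropped
(unneeded: 0 warnings without it; the gate notes linter disabling as lint debt).  Nothing here proves BSD.
Census = BC5 WITNESS: FE frame 243/243 (-desc g13) + DES13-ENT (entangled `2^j`-Selmer generators: 0/281 at `Δ > 0` vs 2/229 at `Δ < 0`);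
`HOME/data-es/g10/H1LEVELS.txt` 1b0905e3ffc93469 (`es19/h1levels.py` 6d5af6bb8fc1e986 brute force: `#H¹(GL₂(ℤ/2^k),(ℤ/2^j)²) = 2` and
`res_c = (2^{j−1}, 0) ∉` the archimedean Kummer line, `res_w = 0`, for all `1 ≤ j ≤ k ≤ 4`, `k ≥ 2`); ENGINE S (-an g14 kit j307611, certified
index rows 1 576; `CENSUS19-j307611.txt` 5c739b406059afcb): `Δ > 0` minimal rows (`t = s = 0`) 475/475 `U_ok ∧ Full_eq`, `m ≥ 1`: 48/48 with
`(sW, sd) = (0, 2m)` (m = 1: 33, m = 2: 11, …), `m = 0`: 427 with `(dim Sel₂E, dim Sel₂E^d) = (1, 0)`; falsifiers: one `Δ > 0` slice curve with an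
entangled `2^j`-Selmer class kills ES-19a′/a — 0 found; ES-19u 0/475.
REF1 §121 (refuter-bsd-f1-sign2-ref1 g11, 2026-08-28T15:40:55Z; `HOME/REF1-AUDIT-v1.md` l.2356, evidence `REF1-data/b121/`; D-es-52 CLEARED,
D-es-53 ANSWERED): «REF1 §121: Sketch19 fc997b5f67915794 farm rc 0·0·0·0, draft f0aa8ebfb2574b43 decl-identical (9/9); glue + ES-19c kernel-proved
on the standard axioms (tree `two_nsmul_mem_selmerLocalKer_infinitePlace` sorry-free).  ES-19b THEOREM-GRADE IN SUBSTANCE with step (i)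
corrected: `E[2]` is `𝔽₂[S₃]`-projective ⟹ `H¹(GL₂(ℤ/2^k),E[2]) = Hom_{S₃}(Γ/Φ(Γ),E[2]) = 𝔽₂` (`Γ = 1+2M₂`; `Γ/Φ` = `M₂(𝔽₂) ≅ E[2] ⊕ P`
extended by the trivial `M₂/sl₂`; unique equivariant `φ(a b;c d) = (a+b+d, a+c+d)`), all `k ≥ 2` — the memo's lemma
`Hom_G(ker(→GL₂(ℤ/4)),E[2]) = 0` is false (`= ℤ/2`) but the count survives; Sah (`−I`) and the `E[2] ↪ E[2^j] ↠ E[2^{j−1}]` step correct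
⟹ `#I_{k,j} = 2` ∀ `1 ≤ j ≤ k`, `k ≥ 2`; REF1 brute force 20/20 rows `k ≤ 6` (`#Z¹/#B¹ = 2`; `k = 6` kit j311665).  ES-19a′ THEOREM-GRADE IN
SUBSTANCE: `loc_∞ξ_E = φ(E₂₂) = e₁+e₂ = T_mid`, `δ_∞(E(ℝ)/2^j) = ⟨[(0,1)]⟩`, `loc_∞ι_*ξ_E = [(2^{j−1},0)] ∉` Kummer line (numerics 20/20),
`Δ < 0`: `H¹(ℝ,E[2^j]) = 0`.  ES-19a THEOREM-GRADE (glue); twist clause: full 2-adic image is twist-invariant (`−I = (0 −1;1 0)²`).  ES-19c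
PROVED; `d_M(n) = 2d_{M+1}(n)` formal.  ES-19u CONJECTURE (sub-rung of U, glue proved; census replay 1 576 rows, `Δ>0` minimal 475/475 eq,
`m ≥ 1` 48/48 `(0,2m,2)`, 0 violations).  Carriers junk-free (`j ≤ k` present; `h1Eval` evaluated inside `torsionFixing`).  KILLED none.»
Riders r1–r3 (docstring wording of ES-19b step (i), ES-19a′ `ξ(c) = φ(E₂₂)`, ES-19a twist clause) are -es text riders for a later text-only
fold; r4 = this filing (draft as is, grades below); r5/r6 informational.
REF2-PLACEMENT v32 §4 (refuter-bsd-f1-sign2-ref2 g32, 2026-08-28T14:47:56Z; `HOME/REF2-PLACEMENT-v32.md` 41962dcf81f63fad; D-es-54 ANSWERED):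
«REF2 v32 §4: ES-19b KNOWN-type (LW 2016 §7.1 numerics at level 4; tree p639364 at j = 1); ES-19a′ not found in print, finite check,
VARIANT-small; ES-19a RIS⁺ NOT IN PRINT — Gross 1991 Prop. 9.1 and McCallum 1991 §3 state the restriction-injectivity step for p odd only
(centre argument fails at p = 2; LW 2016 records H¹ ≠ 0 at level 4); NEW-COMBINATION-small; beyond-print theorem yes-small if proved.  BSD is
not proved by this.» [cite: LawsonWuthrich2016, §6–§7] [cite: GrossLMS1991, Prop. 9.1] [cite: McCallumLMS1991, §3 Prop. 3.1, §5 Thm. 5.4]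
PARTITION: none moved (frontier tier); beyond-print theorem: no (candidate statements + census; ES-19a yes-small IF proved, REF2).  BSD is not
proved by any of this.
bears_on: 23715 (`ByReductionTypeAtTwo.RankOneAtTwoBigImageOddLocal`; U child `DoorIndexLawUpperCAtTwo`, its `Δ > 0` minimal-door rung ES-19u;
U₀⁺ = `RegularKolyvagin.HeegnerCornerPosDiscAtTwo` p639849), 24883 (gk2 `KolyvaginExactAtTwoPosDisc`); asks D-es-52 (-ty, this file), D-es-53
(REF1), D-es-54 (REF2, answered).

## The sketch's own summary (verbatim)

# MEMO-es §19 (cell `bsd-f1-sign2`, -es g10) — THE REAL SIGNATURE OF THE ČEBOTAREV BLIND SPOT AT `2`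
# and the two `2`-adic archimedean defects of Kolyvagin–McCallum at `Δ_E > 0`

Sketch (statement file + kernel glue; nothing here proves BSD).  Setting of crux
`ByReductionTypeAtTwo.RankOneAtTwoBigImageOddLocal` (stmt-23715): `ρ_{E,2^∞}` onto, odd torsion, odd Tamagawa.

THE OBJECT.  For `k ≥ 2`, `1 ≤ j ≤ k`, the inflation line
  `I_{k,j}(E) := {x ∈ H¹(ℚ, E[2^j]) : x dies on Γ_{ℚ(E[2^k])}} = H¹(GL₂(ℤ/2^k), (ℤ/2^j)²) = ℤ/2 · ι_*ξ_E`
(`ξ_E ∈ H¹(GL₂(ℤ/4), E[2])` the level-`4` entanglement class of MEMO-es §13 / gk2 §51; `ι : E[2] ↪ E[2^j]`; one line for ALL `k, j`: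
surjection `H¹(G,E[2]) ↠ H¹(G,E[2^j])` from Sah's `2·H¹ = 0` (tree `two_zsmul_eq_zero_of_h1Eval_eq_zero`) and the exact sequence of
`0 → E[2] → E[2^j] → E[2^{j-1}] → 0`; brute force `es19/h1levels.py`, `k ≤ 4`).  This line is McCallum's Čebotarev BLIND SPOT at `p = 2`
(the kernel of `Sel_{2^j}(E/ℚ) → Hom(Γ_{ℚ(E[2^k])}, E[2^j])`, McCallum 1991 §3 (2), there `= 0` because `p` is odd).

THE REAL SIGNATURE (ES-19a′).  `loc_∞ ι_*ξ_E = ι_*(loc_∞ ξ_E)`; at `Δ_E < 0` it is `0` (`H¹(ℝ, E[2]) = 0`), at `Δ_E > 0` it is the class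
`[(2^{j-1}, 0)] ∈ H¹(ℝ, E[2^j]) ≅ (ℤ/2)²`, which is NOT in the archimedean Kummer line `δ_∞(E(ℝ)/2^j) = ⟨[(0,1)]⟩` (basis
`ω₁/2^j` real, `ω₂/2^j` imaginary; table `H1LEVELS.txt`: `res_c = (2^{j-1}, 0)` for every `(k,j)`, `k ≤ 4`).  HENCE

* ES-19a (RIS⁺, THEOREM-grade candidate): at `Δ_E > 0` NO non-zero class of `H¹(ℚ, E[2^j])` satisfying the archimedean Kummer
  condition dies on `Γ_{ℚ(E[2^k])}`; in particular `Sel_{2^j}(E/ℚ)` and `Sel_{2^j}(E^d/ℚ)` (`d < 0`: `Δ_{E^d} > 0`, image still onto)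
  inject into `Hom(Γ_{ℚ(E[2^k])}, ·)` at EVERY level — McCallum's Prop. 3.1/Cor. 3.2 hold verbatim at `p = 2` on `Δ > 0`.
  (At `Δ_E < 0` the blind spot is real-Selmer and is decided at `2N`: gk2 §48's entangled `Sel₂(W) ∋ ξ_W`.)
* ES-19c (ARCH, kernel support below + Kolyvagin reading): a class of `H¹(ℚ, E[n])` whose image in `H¹(ℚ, E)` is a DOUBLE is
  archimedean-Selmer (`H¹(ℝ, E)` is killed by `2`, tree).  Kolyvagin's derived classes from primes of level `≥ M+1`
  (`2^{M+1} ∣ ℓ+1, a_ℓ`) reduced mod `2^M` have `d_M(n) = 2·d_{M+1}(n)`, so the archimedean ERROR PLACE of the lead's G10 §2.6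
  (`H¹(ℂ/ℝ, E(ℂ)) = ℤ/2` at `Δ > 0`) VANISHES for them: the reciprocity law `Σ_v ⟨s_v, c_M(n)_v⟩ = 0` has no `∞`-term.
* ES-19u (payoff, CONJECTURE): the MINIMAL-DOOR `Δ > 0` rung of U = `DoorIndexLawUpperCAtTwo` for ALL layers `m`
  (McCallum's induction at `2` with regular primes of level `m+2`, MEMO-es §18): `ord₂ #Ш(W)[2^∞] + ord₂ #Ш(Wd)[2^∞] ≤ 2m`.
-/

set_option autoImplicit false

noncomputable section

open scoped Classical

namespace Summit.BirchSwinnertonDyer.Rank1Residual.F1Sign2.RealSignatureAtTwo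

open WeierstrassCurve NumberField
open Literature.NumberTheory.EllipticCurves Literature.NumberTheory.EllipticCurves.ModularForms
open Literature.NumberTheory.GaloisRepresentations
open Summit.BirchSwinnertonDyer.BirchSwinnertonDyer.Theorems.RankOneAtTwoOneDoor

/-- **ES-19b `InflationLineAtTwoPow` (support, THEOREM-grade; group cohomology):** for `ρ_{E,2^∞}` onto, `k ≥ 2`, `1 ≤ j ≤ k`,
exactly TWO classes of `H¹(ℚ, E[2^j])` die on `Γ_{ℚ(E[2^k])}` — the inflation group `H¹(GL₂(ℤ/2^k), (ℤ/2^j)²) = ℤ/2`, generated by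
`ι_*ξ_E`.  Proof on paper: gk2 §51 (`#Inf = 2` with `E[2]`-coefficients at every level) + Sah (`2 · Inf = 0`, tree) + the exact
sequence of `E[2] ↪ E[2^j] ↠ E[2^{j-1}]` (the composite `H¹(G,E[2^j]) → H¹(G,E[2^{j-1}]) ↪ H¹(G,E[2^j])` is `·2 = 0` and the
second map is injective since `E[2]^G = 0`, so `H¹(G,E[2]) ↠ H¹(G,E[2^j])`).  Brute force: `#H¹ = 2` for all `1 ≤ j ≤ k ≤ 4`, `k ≥ 2`
(`es19/h1levels.py`, `H1LEVELS.txt`).  Why it might fail: only a slip in the exact-sequence step (checked numerically to `k = 4`).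
[cite: LawsonWuthrich2016, §7.1] [cite: GrossLMS1991, Prop. 9.1]
REF1 §121 grade: THEOREM-GRADE IN SUBSTANCE (with the corrected step (i): `S₃`-Frattini count, not `Hom_G(N, E[2]) = 0`). -/
def InflationLineAtTwoPow : Prop :=
  ∀ (W : WeierstrassCurve ℚ) [W.IsElliptic], (∀ n : ℕ, W.HasSurjectiveModNGaloisRep ((2 ^ n : ℕ) : ℤ)) →
    ∀ (j k : ℕ), 1 ≤ j → j ≤ k → 2 ≤ k →
      Nat.card {x : galH1Torsion W ((2 ^ j : ℕ) : ℤ) //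
        ∀ ρ ∈ torsionFixing W ((2 ^ k : ℕ) : ℤ), h1Eval W ((2 ^ j : ℕ) : ℤ) x ρ = 0} = 2

/-- **ES-19a′ `RealSignatureOfBlindSpotAtTwo` (candidate, THEOREM-grade; NEW as a statement): the archimedean signature of the
Čebotarev blind spot is the sign of the discriminant.**  For `ρ_{E,2^∞}` onto, `1 ≤ j ≤ k`, a NON-ZERO class `x ∈ H¹(ℚ, E[2^j])` dying on
`Γ_{ℚ(E[2^k])}` satisfies the archimedean Selmer condition iff `Δ_E < 0`.  (`x = ι_*ξ_E` by ES-19b; `loc_∞ ξ_E = (sign(-Δ h'(θ_i)))_i`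
is `T_mid ≠ 0, ∉ δ_∞(E(ℝ)) = {0, T_min}` at `Δ > 0` (MEMO-es §13 NEGDISC) and `ι_*T_mid = [(2^{j-1},0)] ∉ ⟨[(0,1)]⟩ = δ_∞(E(ℝ)/2^j)`;
at `Δ < 0`, `H¹(ℝ, E[2^j]) = 0` for the free `ℤ/2^j[c]`-module.)  Table: `res_c ∉` Kummer line and `res_w = 0` for all `(k,j)`, `k ≤ 4`.
Why it might fail: a basis slip in `δ_∞(egg) = [(0,±1)]` (checked: `ι_*δ₂(egg) = δ_{2^j}(2^{j-1}·egg) = 0` forces `T_min = (0,1)`).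
Cheapest falsifier: ONE `Δ > 0` curve of the slice with an entangled `2^j`-Selmer class (DES13-ENT: entangled generators only at
`Δ < 0`, 2/510). [cite: LawsonWuthrich2016, §6–§7] [cite: GrossLMS1991, Prop. 9.1]
REF1 §121 grade: THEOREM-GRADE IN SUBSTANCE (`loc_∞ ξ_E = φ(E₂₂) = e₁ + e₂ = T_mid` identically). -/
def RealSignatureOfBlindSpotAtTwo : Prop :=
  ∀ (W : WeierstrassCurve ℚ) [W.IsElliptic], (∀ n : ℕ, W.HasSurjectiveModNGaloisRep ((2 ^ n : ℕ) : ℤ)) →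
    ∀ (j k : ℕ), 1 ≤ j → j ≤ k →
    ∀ x : galH1Torsion W ((2 ^ j : ℕ) : ℤ), x ≠ 0 →
      (∀ ρ ∈ torsionFixing W ((2 ^ k : ℕ) : ℤ), h1Eval W ((2 ^ j : ℕ) : ℤ) x ρ = 0) →
      ∀ w : InfinitePlace ℚ, (x ∈ selmerLocalKer W w.Completion ((2 ^ j : ℕ) : ℤ) ↔ W.Δ < 0)

/-- **ES-19a `SelmerRestrictionInjectivePosDiscAtTwo` (RIS⁺; candidate, THEOREM-grade; NEW as a statement): at `Δ_E > 0` the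
Čebotarev blind spot misses every archimedean-Selmer class, at every level.**  For `0 < Δ_W`, `ρ_{W,2^∞}` onto, `1 ≤ j ≤ k`: a class
`x ∈ H¹(ℚ, E[2^j])` in the archimedean local kernel that dies on `Γ_{ℚ(E[2^k])}` is `0`.  Consequence: `Sel_{2^j}(E/ℚ) ↪
Hom_G(Γ_{ℚ(E[2^k])}, E[2^j])` (and the same for every twist `E^d`, `d < 0`, which again has `Δ > 0` and onto image) — McCallum 1991
Prop. 3.1 / Cor. 3.2 and Gross 1991 Prop. 9.1's use hold at `p = 2` on `Δ > 0` with NO blind spot.  Why it might fail: as ES-19a′.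
Cheapest falsifier: as ES-19a′. [cite: McCallumLMS1991, §3 Prop. 3.1] [cite: GrossLMS1991, Prop. 9.1]
REF1 §121 grade: THEOREM-GRADE (kernel glue from ES-19a′; twist clause certified: the full `2`-adic image is twist-invariant). -/
def SelmerRestrictionInjectivePosDiscAtTwo : Prop :=
  ∀ (W : WeierstrassCurve ℚ) [W.IsElliptic], 0 < W.Δ → (∀ n : ℕ, W.HasSurjectiveModNGaloisRep ((2 ^ n : ℕ) : ℤ)) →
    ∀ (j k : ℕ), 1 ≤ j → j ≤ k →
    ∀ x : galH1Torsion W ((2 ^ j : ℕ) : ℤ),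
      (∀ w : InfinitePlace ℚ, x ∈ selmerLocalKer W w.Completion ((2 ^ j : ℕ) : ℤ)) →
      (∀ ρ ∈ torsionFixing W ((2 ^ k : ℕ) : ℤ), h1Eval W ((2 ^ j : ℕ) : ℤ) x ρ = 0) → x = 0

/-- Glue (kernel): the real-signature dichotomy gives RIS⁺. -/
theorem selmerRestrictionInjectivePosDisc_of_realSignature (h : RealSignatureOfBlindSpotAtTwo) :
    SelmerRestrictionInjectivePosDiscAtTwo := by
  intro W _ hΔ hsurj j k hj hjk x hloc hdies
  by_contra hx
  obtain ⟨w⟩ := (inferInstance : Nonempty (InfinitePlace ℚ))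
  have hneg : W.Δ < 0 := (h W hsurj j k hj hjk x hx hdies w).1 (hloc w)
  exact absurd hneg (not_lt.mpr hΔ.le)

/-- Glue (kernel): RIS⁺ on the `2^j`-Selmer group — McCallum's restriction (2) is injective on `Sel_{2^j}(E/ℚ)` at `Δ > 0`. -/
theorem selmer_eq_zero_of_dies (h : SelmerRestrictionInjectivePosDiscAtTwo) (W : WeierstrassCurve ℚ) [W.IsElliptic]
    (hΔ : 0 < W.Δ) (hsurj : ∀ n : ℕ, W.HasSurjectiveModNGaloisRep ((2 ^ n : ℕ) : ℤ)) (j k : ℕ) (hj : 1 ≤ j) (hjk : j ≤ k)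
    (x : galH1Torsion W ((2 ^ j : ℕ) : ℤ)) (hx : x ∈ selmerGroup W ((2 ^ j : ℕ) : ℤ))
    (hdies : ∀ ρ ∈ torsionFixing W ((2 ^ k : ℕ) : ℤ), h1Eval W ((2 ^ j : ℕ) : ℤ) x ρ = 0) : x = 0 :=
  h W hΔ hsurj j k hj hjk x ((mem_selmerGroup_iff W _ x).1 hx).2 hdies

/-- **ES-19c (ARCH, kernel SUPPORT from the tree): a class of `H¹(K, E[n])` whose image in `H¹(K, E)` is a double satisfies the
archimedean Selmer condition at every infinite place** (`2 · H¹(ℝ, E) = 0`, tree `two_nsmul_mem_localRestrictionKer_infinitePlace`).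
Kolyvagin reading (MEMO-es §19.4): with Kolyvagin primes of level `≥ M+1` the derived class mod `2^M` is the reduction of the class mod
`2^{M+1}`, so `d_M(n) = 2 · d_{M+1}(n)` in `H¹(ℚ, E^{(ε_n)})` and the archimedean error place carries nothing. [cite: SerreGaloisCohomology1997, I.§2.4] -/
theorem mem_selmerLocalKer_infinitePlace_of_eq_two_nsmul {K : Type} [Field K] [NumberField K] (V : WeierstrassCurve K)
    (n : ℤ) (w : InfinitePlace K) (c : galH1Torsion V n) (c' : V.galH1) (h : torsionH1ToH1 V n c = 2 • c') :
    c ∈ selmerLocalKer V w.Completion n := by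
  rw [mem_selmerLocalKer_iff_torsionH1ToH1_mem, h]
  exact two_nsmul_mem_localRestrictionKer_infinitePlace V w c'

/-- **ES-19u `DoorIndexLawUpperCAtTwoMinimalPos` (payoff candidate, CONJECTURE; beyond print): the `Δ > 0` MINIMAL-DOOR rung of the
Euler-system half U, ALL layers.**  Binders VERBATIM `DoorIndexLawUpperCAtTwo` plus `0 < W.Δ`, a minimal door (`t + 2s = 0`: only
3-cycle primes divide `d_K`) and `Odd Dt.c`; then for every exponent `m`: `ord₂ #Ш(W)[2^∞] + ord₂ #Ш(Wd)[2^∞] ≤ 2m`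
(`minimalPos_conclusion_iff`).  Mechanism (MEMO-es §19): McCallum's 1991 induction at `p = 2` — (α) the Čebotarev blind spot is EMPTY on
`Sel_{2^j}(W)`, `Sel_{2^j}(Wd)` (ES-19a); (β) the archimedean error place is killed by one extra level (ES-19c); (γ) regular primes of
level `m+2` give free local modules (MEMO-es §18); at a minimal `Δ > 0` door there is no finite error place (`2` split, 3-cycle primes).
The `m = 0` corner is U₀⁺ (`DoorIndexLawUpperCAtTwoBottom`).  Census (ENGINE S j307611, `Δ > 0` minimal rows): see MEMO-es §19.6.
Why it might fail: McCallum's Lemma 5.3 auxiliary class (Poitou–Tate with prescribed local conditions) and the `R_M`-linear structure step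
(Thm. 5.4) at `2` (item 24882's `Δ > 0` twin 24883).
REF1 §121: CONJECTURE (sub-rung of U `DoorIndexLawUpperCAtTwo`; glue `doorIndexLawUpperCAtTwoMinimalPos_of_upperC` kernel-proved; census replay
1 576 certified rows, `Δ > 0` minimal 475/475, 0 violations).  REF2 v32 §4: the payoff row is conjecture-grade (beyond print); tagged `@[conjecture]` (D-es-52, typer edit: attribute only).
[cite: McCallumLMS1991, §5 Thm. 5.4, Cor. 5.6] [cite: Kolyvagin1990, Thm. A] -/
@[conjecture] def DoorIndexLawUpperCAtTwoMinimalPos : Prop :=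
  ∀ (W : WeierstrassCurve ℚ) [W.IsElliptic] [W.IsGloballyMinimal] [NeZero (W.conductorNorm ℤ)],
    ¬ W.HasCM → (∀ n : ℕ, W.HasSurjectiveModNGaloisRep ((2 ^ n : ℕ) : ℤ)) → Odd W.torsionOrder → Odd W.tamagawaProduct →
    W.analyticRank = 1 → 0 < W.Δ →
    ∀ (K : Type) [Field K] [NumberField K], IsImaginaryQuadratic K →
      DoorAdmissible W (NumberField.discr K) →
      (W.quadraticTwist (NumberField.discr K : ℚ)).entireLFunction 1 ≠ 0 →
      ∀ (Dt : ModularParametrizationData W (W.conductorNorm ℤ))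
        (H : HeegnerDatum (W.conductorNorm ℤ) (NumberField.discr K)) (ι : K →+* ℂ)
        (P : (W.baseChange K).toAffine.Point),
        WeierstrassCurve.Affine.Point.map ι.toRatAlgHom P = heegnerPointComplex Dt H →
        ∀ (Wd : WeierstrassCurve ℚ) [Wd.IsElliptic] [Wd.IsGloballyMinimal] (Cd : WeierstrassCurve.VariableChange ℚ),
          Cd • W.quadraticTwist (NumberField.discr K : ℚ) = Wd →
          transpCount W (NumberField.discr K) + 2 * identCount W (NumberField.discr K) = 0 → Odd Dt.c →
          ∀ m : ℕ, HasTwoDivisibilityUpToTorsion W K P m →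
            padicValNat 2 (Nat.card (AddCommGroup.primaryComponent W.sha 2)) +
                padicValNat 2 (Nat.card (AddCommGroup.primaryComponent Wd.sha 2)) +
                transpCount W (NumberField.discr K) + 2 * identCount W (NumberField.discr K) +
                2 * padicValInt 2 Dt.c ≤
              2 * m + (if W.Δ < 0 then 1 else 0)

/-- Glue (kernel): U gives its `Δ > 0` minimal-door rung. -/
theorem doorIndexLawUpperCAtTwoMinimalPos_of_upperC (h : DoorIndexLawUpperCAtTwo) : DoorIndexLawUpperCAtTwoMinimalPos := by
  intro W _ _ _ hCM hsurj hT hc hr _hΔ K _ _ hK hadm hL Dt H ι P hP Wd _ _ Cd hCd _hmin _hodd m hm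
  exact h W hCM hsurj hT hc hr K hK hadm hL Dt H ι P hP Wd Cd hCd m hm

/-- Reading of ES-19u's conclusion (import-free arithmetic): at a minimal `Δ > 0` door with odd constant the door inequality says
`ord₂ #Ш(W)[2^∞] + ord₂ #Ш(Wd)[2^∞] ≤ 2m`. -/
theorem minimalPos_conclusion_iff (Δ : ℚ) (hΔ : 0 < Δ) (sW sd t s m : ℕ) (c : ℤ) (hmin : t + 2 * s = 0) (hodd : Odd c) :
    (sW + sd + t + 2 * s + 2 * padicValInt 2 c ≤ 2 * m + (if Δ < 0 then 1 else 0)) ↔ sW + sd ≤ 2 * m := by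
  have h2 : ¬ (2 : ℤ) ∣ c := fun h => (Int.not_even_iff_odd.mpr hodd) (even_iff_two_dvd.mpr h)
  have hv : padicValInt 2 c = 0 := padicValInt.eq_zero_of_not_dvd (by exact_mod_cast h2)
  rw [if_neg (not_lt.mpr hΔ.le), hv]
  omega

end Summit.BirchSwinnertonDyer.Rank1Residual.F1Sign2.RealSignatureAtTwo
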